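import Literature.AlgebraicGeometry.Modules.IsoLocusOfHom
import Literature.AlgebraicGeometry.Modules.PushforwardBaseChangeIsoOfFibreVanishingGeneralBase
import Literature.AlgebraicGeometry.Motives.GrassmannianUniversalSubbundle
import Literature.AlgebraicGeometry.Motives.OpenSubfunctorRepresentable
import Literature.AlgebraicGeometry.Modules.PushforwardHasRankOfFibreVanishing
import HarnessLib

/-!
# The complete-linear-system locus: where a frame `𝒪_S^r → p_* G` is an isomorphism, and its reading after base change

Topic `AlgebraicGeometry/Modules`; namespace `Literature.AlgebraicGeometry.Modules`.  THEOREMS ONLY (no definition, no instance,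
no notation, no named fact, no `sorry`).  Cell `hodgecm-mathlib` (D-0151), F-DAG leaf F-6 (VI) «the embedding is the complete linear
system», FILE C of B-p04 (g20)'s assembler census `B-provers/B-p04/g20/CENSUS-F6-VI-Assembler.B-p04g20.md` (cut to B-p06 (g12)
07:55:35Z; census `B-provers/B-p06/g12/CENSUS-F6VI-FileC-CompleteLinearSystemLocus.B-p06g12.md`).  Count-neutral Mathlib-side
capital: HC_CM is proved only modulo the 7 printed citations until rung 0 closes — nothing here is about HC.

[MumfordFogartyKirwan1994] Ch. 7 §2, proof of Prop. 7.3, step (VI) (p. 134): among the `T`-valued points of `H₅` one cuts out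
«the subfunctor of those for which the embedding `A_T ⊂ ℙ^m_T` is given by the COMPLETE linear system», i.e. for which the
restriction `𝒪_T ⊗ H⁰(ℙ^m, 𝒪(1)) = 𝒪_T^{m+1} → (π_T)_* L_T` is an ISOMORPHISM; since `π_* L` is locally free of rank `m+1` and
its formation commutes with base change, this is represented by an OPEN subscheme.  In the tree's currency ([StacksProject, Tag
05P8]; [GortzWedhorn2020] Thm. 8.9 for the functor of points of an open subscheme):

* §1 (any `p : X ⟶ S`, `u : 𝒪_S^r ⟶ p_* G` with `p_* G` of rank `r`):
  **`exists_opens_iso_yoneda_isIso_pullback_map`** — there are an open `U ⊆ S` and a sub-functor `P ⊆ h_S` represented by `U`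
  (compatibly with `U ↪ S`) with `g ∈ P(T) ⟺ g^*u` is an isomorphism (★ B-p18 `exists_subfunctor_isoLocus_of_hasRank`,
  `exists_iso_yoneda_isoLocus`, with ★ `hasRank_freeModule`); the Subfunctor-free reading
  **`exists_opens_forall_exists_comp_ι_iff_isIso_pullback_map`** — `g : T ⟶ S` FACTORS THROUGH `U` iff `g^*u` is an isomorphism
  (`exists_comp_opensι_eq_iff_mem_of_iso_yoneda`), pointwise `s ∈ U ⟺ (Spec κ(s) → S)^* u` is an isomorphism.
* §2 (`p` proper flat over a locally Noetherian `S`, `G` finite locally free with the fibrewise vanishing `hvan` of ★ G10):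
  **`isIso_pullback_map_iff_isIso_comp_pushforwardBaseChangeHom`** — THE (VI)-READING: for every cartesian square `H` over
  `g : T ⟶ S` and every `u : E ⟶ p_* G`, `g^*u` is an isomorphism iff `g^*u ≫ β_H : g^*E ⟶ (p_T)_*(pr^* G)` is, because the
  base-change morphism `β_H = pushforwardBaseChangeHom H.w G` is an isomorphism (★ B-p19 G10
  `isIso_pushforwardBaseChangeHom_of_forall_fieldPoint`): «the `r` sections restricted to `X_T` frame `(π_T)_* L_T`».
* §3 **`exists_opens_forall_exists_comp_ι_iff_isIso_comp_pushforwardBaseChangeHom`** — §1 + §2: ONE open `U ⊆ S` such that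
  `g : T ⟶ S` factors through `U` iff `g^*u ≫ β_H` is an isomorphism for any (every) cartesian square `H` over `g` — the open
  subscheme representing «the embedding of `X_T` is by the complete linear system».

The rank hypothesis `hR : HasRank (p_* G) r` is a binder (discharged by the assembler's FILE B
`hasRank_pushforward_of_forall_fieldPoint`); the map `u` itself and the identification `H⁰(ℙ^m, 𝒪(1)) ⊗ 𝒪_T = 𝒪_T^{m+1}` belong
to the F-6 functor-side file that owns the embedding.

## References
* [MumfordFogartyKirwan1994] D. Mumford, J. Fogarty, F. Kirwan, *Geometric Invariant Theory*, 3rd ed. (1994), Ch. 7 §2, Prop. 7.3,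
  step (VI) of the proof (p. 134).
* [StacksProject] The Stacks Project, Tag 05P8.
* [GortzWedhorn2020] U. Görtz, T. Wedhorn, *Algebraic Geometry I*, 2nd ed. (2020), Thm. 8.9 (p. 212).
* [Hartshorne1977] R. Hartshorne, *Algebraic Geometry* (1977), III Thm. 12.11 (p. 290).
-/

noncomputable section

-- `TopCat.Presheaf`/`Scheme.Modules` are not reducible (as in Mathlib's `AlgebraicGeometry/Modules/Tilde.lean`).
set_option backward.isDefEq.respectTransparency false

open CategoryTheory CategoryTheory.Limits CategoryTheory.Abelian AlgebraicGeometry TopologicalSpace Opposite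

namespace Literature.AlgebraicGeometry.Modules

open Literature.AlgebraicGeometry.Motives Literature.AlgebraicGeometry.Morphisms

universe u

/-! ## §1 The frame locus of `u : 𝒪_S^r ⟶ p_* G` is represented by an open subscheme -/

section FrameLocus

/-- **Functor of points of an open subscheme, through a representing isomorphism**: if `e : h_U ≅ P` identifies the open
subscheme `U ⊆ S` with a sub-functor `P ⊆ h_S` compatibly with the inclusions, then `g : T ⟶ S` factors through `U ↪ S` iff
`g ∈ P(T)`. [cite: GortzWedhorn2020, Thm. 8.9 (p. 212)] -/
theorem exists_comp_opensι_eq_iff_mem_of_iso_yoneda {S : Scheme.{u}} (U : S.Opens) (P : Subfunctor (yoneda.obj S))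
    (e : yoneda.obj (U : Scheme.{u}) ≅ P.toFunctor) (hι : e.hom ≫ P.ι = yoneda.map U.ι) {T : Scheme.{u}} (g : T ⟶ S) :
    (∃ g' : T ⟶ (U : Scheme.{u}), g' ≫ U.ι = g) ↔ g ∈ P.obj (op T) := by
  constructor
  · rintro ⟨g', rfl⟩
    -- `g' ≫ U.ι = (h_{U.ι})(g') = (e.hom ≫ P.ι)(g') = (e.hom g').1 ∈ P(T)`
    have h1 : ((e.hom.app (op T) g').1 : T ⟶ S) = g' ≫ U.ι := by
      change ((e.hom ≫ P.ι).app (op T) g' : T ⟶ S) = g' ≫ U.ι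
      rw [hι]
      rfl
    rw [← h1]
    exact (e.hom.app (op T) g').2
  · intro hg
    refine ⟨e.inv.app (op T) ⟨g, hg⟩, ?_⟩
    change ((yoneda.map U.ι).app (op T) (e.inv.app (op T) ⟨g, hg⟩) : T ⟶ S) = g
    rw [← hι]
    change ((P.ι.app (op T) (e.hom.app (op T) (e.inv.app (op T) ⟨g, hg⟩))) : T ⟶ S) = g
    rw [Iso.inv_hom_id_app_apply]
    rfl

variable {S X : Scheme.{0}} {p : X ⟶ S} (G : X.Modules) {r : ℕ}
  (hR : HasRank ((Scheme.Modules.pushforward p).obj G) r)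
  (u : freeModule S (Fin r) ⟶ (Scheme.Modules.pushforward p).obj G)

include hR in
/-- **THE FRAME LOCUS OF `u : 𝒪_S^r ⟶ p_* G` IS AN OPEN SUB-FUNCTOR, REPRESENTED BY AN OPEN SUBSCHEME `U ⊆ S`** (for `p_* G`
of rank `r`): there are an open `U ⊆ S`, a sub-functor `P ⊆ h_S` and an isomorphism `h_U ≅ P` over `h_S` with
`g ∈ P(T) ⟺ g^*u : 𝒪_T^r ⟶ g^*(p_* G)` is an isomorphism — ★ `exists_subfunctor_isoLocus_of_hasRank` /
`exists_iso_yoneda_isoLocus` for the two rank-`r` modules `𝒪_S^r` (★ `hasRank_freeModule`) and `p_* G`; `U = S ∖ Supp (coker u)`.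
MFK: «since `π_* L` is locally free of rank `m+1` … this subfunctor is represented by an open subscheme».
[cite: MumfordFogartyKirwan1994, Ch. 7 §2 Prop. 7.3, step (VI) of the proof (p. 134)] [cite: StacksProject, Tag 05P8] -/
theorem exists_opens_iso_yoneda_isIso_pullback_map :
    ∃ (U : S.Opens) (P : Subfunctor (yoneda.obj S)) (e : yoneda.obj (U : Scheme.{0}) ≅ P.toFunctor),
      e.hom ≫ P.ι = yoneda.map U.ι ∧
        ∀ {T : Scheme.{0}} (g : T ⟶ S), g ∈ P.obj (op T) ↔ IsIso ((Scheme.Modules.pullback g).map u) := by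
  have hE : HasRank (freeModule S (Fin r)) r := by
    simpa only [Fintype.card_fin] using hasRank_freeModule S (Fin r)
  obtain ⟨P, hP⟩ := exists_subfunctor_isoLocus_of_hasRank u hE hR
  obtain ⟨e, he⟩ := exists_iso_yoneda_isoLocus u
    (coh_of_isVectorBundle (HasRank.isFiniteLocallyFree' hE).isVectorBundle).loc
    (coh_of_isVectorBundle (HasRank.isFiniteLocallyFree' hR).isVectorBundle).loc
    (coh_of_isVectorBundle (HasRank.isFiniteLocallyFree' hR).isVectorBundle).ft hE hR P (fun g => hP g)
  exact ⟨_, P, e, by rw [he, Iso.refl_hom, Category.comp_id], fun g => hP g⟩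

include hR in
/-- **`g : T ⟶ S` FACTORS THROUGH THE OPEN FRAME LOCUS `U ⊆ S` IFF `g^*u` IS AN ISOMORPHISM** — the Subfunctor-free reading
of `exists_opens_iso_yoneda_isIso_pullback_map` (functor of points of an open subscheme, [GortzWedhorn2020] Thm. 8.9).
[cite: MumfordFogartyKirwan1994, Ch. 7 §2 Prop. 7.3, step (VI) of the proof (p. 134)] [cite: StacksProject, Tag 05P8]
[cite: GortzWedhorn2020, Thm. 8.9 (p. 212)] -/
theorem exists_opens_forall_exists_comp_ι_iff_isIso_pullback_map :
    ∃ U : S.Opens, ∀ {T : Scheme.{0}} (g : T ⟶ S),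
      (∃ g' : T ⟶ (U : Scheme.{0}), g' ≫ U.ι = g) ↔ IsIso ((Scheme.Modules.pullback g).map u) := by
  obtain ⟨U, P, e, hι, hP⟩ := exists_opens_iso_yoneda_isIso_pullback_map G hR u
  exact ⟨U, fun g => (exists_comp_opensι_eq_iff_mem_of_iso_yoneda U P e hι g).trans (hP g)⟩

include hR in
/-- **Pointwise reading**: there is an open `U ⊆ S` representing the frame locus whose points are exactly the `s ∈ S` at which
`u ⊗ κ(s) : κ(s)^r → (p_* G) ⊗ κ(s)` is an isomorphism, i.e. `(Spec κ(s) → S)^* u` is an isomorphism (the image of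
`Spec κ(s) → S` is `{s}`, Mathlib `Scheme.range_fromSpecResidueField`). [cite: StacksProject, Tag 05P8]
[cite: GortzWedhorn2020, Thm. 8.9 (p. 212)] -/
theorem exists_opens_forall_mem_iff_isIso_pullback_map_fromSpecResidueField :
    ∃ U : S.Opens, (∀ {T : Scheme.{0}} (g : T ⟶ S),
        (∃ g' : T ⟶ (U : Scheme.{0}), g' ≫ U.ι = g) ↔ IsIso ((Scheme.Modules.pullback g).map u)) ∧
      ∀ s : S, s ∈ U ↔ IsIso ((Scheme.Modules.pullback (S.fromSpecResidueField s)).map u) := by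
  obtain ⟨U, hU⟩ := exists_opens_forall_exists_comp_ι_iff_isIso_pullback_map G hR u
  refine ⟨U, fun g => hU g, fun s => ?_⟩
  rw [← hU, exists_comp_opensι_eq_iff_range_subset, Scheme.range_fromSpecResidueField, Set.singleton_subset_iff,
    SetLike.mem_coe]

end FrameLocus

/-! ## §2 The (VI)-reading: `g^*u` is an isomorphism iff the sections restricted to `X_T` frame `(p_T)_*(pr^* G)` -/

section Reading

variable {S X T XT : Scheme.{0}} [IsLocallyNoetherian S] {p : X ⟶ S} [IsProper p] [Flat p] (G : X.Modules)

/-- **THE (VI)-READING** ([MumfordFogartyKirwan1994] Prop. 7.3, step (VI) of the proof, p. 134): for `p : X ⟶ S` proper and flat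
over a locally Noetherian `S`, `G` finite locally free on `X` with `p_* G` affine-localizing and the fibrewise vanishing
`H¹(X_x, G_x) = 0` at every field-valued point (`hvan`, the hypothesis of ★ G10), every cartesian square `H : XT = X ×_S T` over
`g : T ⟶ S` and every `u : E ⟶ p_* G`: `g^*u` is an isomorphism iff the composite `g^*E ⟶ g^*(p_* G) ⟶ (p_T)_*(pr^* G)` with the
base-change morphism is — because the base-change morphism `pushforwardBaseChangeHom H.w G` is an isomorphism (★
`isIso_pushforwardBaseChangeHom_of_forall_fieldPoint`, «`π_* L` commutes with base change», [Hartshorne1977] III 12.11).  With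
`E = 𝒪_S^{m+1}`, `G = L`: «the embedding of `X_T` is by the complete linear system» iff the `m+1` sections restricted to `X_T`
frame `(π_T)_* L_T`. [cite: MumfordFogartyKirwan1994, Ch. 7 §2 Prop. 7.3, step (VI) of the proof (p. 134)]
[cite: Hartshorne1977, III Thm. 12.11 (p. 290)] -/
theorem isIso_pullback_map_iff_isIso_comp_pushforwardBaseChangeHom (hL : IsFiniteLocallyFree G)
    (hN : IsAffineLocalizing ((Scheme.Modules.pushforward p).obj G))
    (hvan : ∀ ⦃K : Type⦄ [Field K] ⦃X₀ : Scheme.{0}⦄ (i : X₀ ⟶ X) (f₀ : X₀ ⟶ Spec (CommRingCat.of K))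
      (x : Spec (CommRingCat.of K) ⟶ S), IsPullback i f₀ p x →
        Subsingleton (Ext.{1} (unitModule X₀) ((Scheme.Modules.pullback i).obj G) 1))
    {pr : XT ⟶ X} {pT : XT ⟶ T} {g : T ⟶ S} (H : IsPullback pr pT p g) {E : S.Modules}
    (u : E ⟶ (Scheme.Modules.pushforward p).obj G) :
    IsIso ((Scheme.Modules.pullback g).map u) ↔
      IsIso ((Scheme.Modules.pullback g).map u ≫ pushforwardBaseChangeHom H.w G) := by
  haveI := isIso_pushforwardBaseChangeHom_of_forall_fieldPoint G hL hN hvan H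
  constructor
  · intro h
    infer_instance
  · intro h
    exact IsIso.of_isIso_comp_right _ (pushforwardBaseChangeHom H.w G)

/-- The (VI)-reading over a quasi-compact locally Noetherian base, with no affine-localizing hypothesis (★
`isIso_pushforwardBaseChangeHom_of_forall_fieldPoint_of_compactSpace`).
[cite: MumfordFogartyKirwan1994, Ch. 7 §2 Prop. 7.3, step (VI) of the proof (p. 134)] [cite: Hartshorne1977, III Thm. 12.11 (p. 290)] -/
theorem isIso_pullback_map_iff_isIso_comp_pushforwardBaseChangeHom_of_compactSpace [CompactSpace S]
    (hL : IsFiniteLocallyFree G)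
    (hvan : ∀ ⦃K : Type⦄ [Field K] ⦃X₀ : Scheme.{0}⦄ (i : X₀ ⟶ X) (f₀ : X₀ ⟶ Spec (CommRingCat.of K))
      (x : Spec (CommRingCat.of K) ⟶ S), IsPullback i f₀ p x →
        Subsingleton (Ext.{1} (unitModule X₀) ((Scheme.Modules.pullback i).obj G) 1))
    {pr : XT ⟶ X} {pT : XT ⟶ T} {g : T ⟶ S} (H : IsPullback pr pT p g) {E : S.Modules}
    (u : E ⟶ (Scheme.Modules.pushforward p).obj G) :
    IsIso ((Scheme.Modules.pullback g).map u) ↔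
      IsIso ((Scheme.Modules.pullback g).map u ≫ pushforwardBaseChangeHom H.w G) := by
  haveI := isIso_pushforwardBaseChangeHom_of_forall_fieldPoint_of_compactSpace G hL hvan H
  constructor
  · intro h
    infer_instance
  · intro h
    exact IsIso.of_isIso_comp_right _ (pushforwardBaseChangeHom H.w G)

end Reading

/-! ## §3 The complete-linear-system locus -/

section Locus

variable {S X : Scheme.{0}} [IsLocallyNoetherian S] {p : X ⟶ S} [IsProper p] [Flat p] (G : X.Modules)
  {r : ℕ} (hR : HasRank ((Scheme.Modules.pushforward p).obj G) r)

include hR in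
/-- **THE COMPLETE-LINEAR-SYSTEM LOCUS IS AN OPEN SUBSCHEME** ([MumfordFogartyKirwan1994] Prop. 7.3, step (VI) of the proof, p.
134): for `p : X ⟶ S` proper flat over a locally Noetherian `S`, `G` finite locally free with `p_* G` affine-localizing of rank
`r` and fibrewise `H¹ = 0` (`hvan`), and a frame `u : 𝒪_S^r ⟶ p_* G`, there is ONE open `U ⊆ S` such that for every `g : T ⟶ S`
and every cartesian square `H : XT = X ×_S T` over `g`: `g` factors through `U` iff `𝒪_T^r = g^*𝒪_S^r ⟶ (p_T)_*(pr^* G)` (the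
`r` sections restricted to `X_T`) is an isomorphism — «the embedding of `X_T` is by the complete linear system» is represented
by the open subscheme `U`. [cite: MumfordFogartyKirwan1994, Ch. 7 §2 Prop. 7.3, step (VI) of the proof (p. 134)]
[cite: StacksProject, Tag 05P8] [cite: GortzWedhorn2020, Thm. 8.9 (p. 212)] -/
theorem exists_opens_forall_exists_comp_ι_iff_isIso_comp_pushforwardBaseChangeHom (hL : IsFiniteLocallyFree G)
    (hN : IsAffineLocalizing ((Scheme.Modules.pushforward p).obj G))
    (hvan : ∀ ⦃K : Type⦄ [Field K] ⦃X₀ : Scheme.{0}⦄ (i : X₀ ⟶ X) (f₀ : X₀ ⟶ Spec (CommRingCat.of K))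
      (x : Spec (CommRingCat.of K) ⟶ S), IsPullback i f₀ p x →
        Subsingleton (Ext.{1} (unitModule X₀) ((Scheme.Modules.pullback i).obj G) 1))
    (u : freeModule S (Fin r) ⟶ (Scheme.Modules.pushforward p).obj G) :
    ∃ U : S.Opens, ∀ {T XT : Scheme.{0}} (g : T ⟶ S) {pr : XT ⟶ X} {pT : XT ⟶ T} (H : IsPullback pr pT p g),
      (∃ g' : T ⟶ (U : Scheme.{0}), g' ≫ U.ι = g) ↔
        IsIso ((Scheme.Modules.pullback g).map u ≫ pushforwardBaseChangeHom H.w G) := by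
  obtain ⟨U, hU⟩ := exists_opens_forall_exists_comp_ι_iff_isIso_pullback_map G hR u
  exact ⟨U, fun g _ _ H =>
    (hU g).trans (isIso_pullback_map_iff_isIso_comp_pushforwardBaseChangeHom G hL hN hvan H u)⟩

include hR in
/-- The complete-linear-system locus over a quasi-compact locally Noetherian base (no affine-localizing hypothesis).
[cite: MumfordFogartyKirwan1994, Ch. 7 §2 Prop. 7.3, step (VI) of the proof (p. 134)] [cite: StacksProject, Tag 05P8] -/
theorem exists_opens_forall_exists_comp_ι_iff_isIso_comp_pushforwardBaseChangeHom_of_compactSpace [CompactSpace S]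
    (hL : IsFiniteLocallyFree G)
    (hvan : ∀ ⦃K : Type⦄ [Field K] ⦃X₀ : Scheme.{0}⦄ (i : X₀ ⟶ X) (f₀ : X₀ ⟶ Spec (CommRingCat.of K))
      (x : Spec (CommRingCat.of K) ⟶ S), IsPullback i f₀ p x →
        Subsingleton (Ext.{1} (unitModule X₀) ((Scheme.Modules.pullback i).obj G) 1))
    (u : freeModule S (Fin r) ⟶ (Scheme.Modules.pushforward p).obj G) :
    ∃ U : S.Opens, ∀ {T XT : Scheme.{0}} (g : T ⟶ S) {pr : XT ⟶ X} {pT : XT ⟶ T} (H : IsPullback pr pT p g),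
      (∃ g' : T ⟶ (U : Scheme.{0}), g' ≫ U.ι = g) ↔
        IsIso ((Scheme.Modules.pullback g).map u ≫ pushforwardBaseChangeHom H.w G) := by
  obtain ⟨U, hU⟩ := exists_opens_forall_exists_comp_ι_iff_isIso_pullback_map G hR u
  exact ⟨U, fun g _ _ H =>
    (hU g).trans (isIso_pullback_map_iff_isIso_comp_pushforwardBaseChangeHom_of_compactSpace G hL hvan H u)⟩

end Locus

/-! ## §4 (ed. 2) The locus from the fibre data alone: `hR` discharged by ★ `hasRank_pushforward_of_forall_fieldPoint` -/

section OfForallFieldPoint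

variable {S X : Scheme.{0}} [IsLocallyNoetherian S] {p : X ⟶ S} [IsProper p] [Flat p] (G : X.Modules)

/-- **THE COMPLETE-LINEAR-SYSTEM LOCUS FROM THE FIBRE DATA** (ed. 2; [MumfordFogartyKirwan1994] Prop. 7.3, step (VI), p. 134 with
Prop. 6.13, p. 123): as ★ `exists_opens_forall_exists_comp_ι_iff_isIso_comp_pushforwardBaseChangeHom`, with the rank hypothesis
`hR : HasRank (p_* G) r` DISCHARGED by ★ `hasRank_pushforward_of_forall_fieldPoint` (B-p04 (g20), `Modules/PushforwardHasRankOfFibreVanishing`)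
from the two fibre inputs: `hvan` (`H¹ = 0`) and `hrank` (`h⁰ = r`, in the `SecMod`/`Γ(Spec K, 𝒪)` currency) on every fibre square over
a field point.  So: `p : X ⟶ S` proper flat, `S` locally Noetherian, `G` finite locally free with `p_* G` affine-localizing, and a frame
`u : 𝒪_S^r ⟶ p_* G`; there is ONE open `U ⊆ S` such that `g : T ⟶ S` factors through `U` iff the `r` sections restricted to `X_T`
frame `(p_T)_*(pr^* G)`. [cite: MumfordFogartyKirwan1994, Ch. 7 §2 Prop. 7.3, step (VI) of the proof (p. 134)]
[cite: MumfordFogartyKirwan1994, Ch. 6 §2 Proposition 6.13 (p. 123)] [cite: StacksProject, Tag 05P8] -/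
theorem exists_opens_forall_exists_comp_ι_iff_isIso_comp_pushforwardBaseChangeHom_of_forall_fieldPoint
    (hL : IsFiniteLocallyFree G) (hN : IsAffineLocalizing ((Scheme.Modules.pushforward p).obj G)) (r : ℕ)
    (hvan : ∀ ⦃K : Type⦄ [Field K] ⦃X₀ : Scheme.{0}⦄ (i : X₀ ⟶ X) (f₀ : X₀ ⟶ Spec (CommRingCat.of K))
      (x : Spec (CommRingCat.of K) ⟶ S), IsPullback i f₀ p x →
        Subsingleton (Ext.{1} (unitModule X₀) ((Scheme.Modules.pullback i).obj G) 1))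
    (hrank : ∀ ⦃K : Type⦄ [Field K] ⦃X₀ : Scheme.{0}⦄ (i : X₀ ⟶ X) (f₀ : X₀ ⟶ Spec (CommRingCat.of K))
      (x : Spec (CommRingCat.of K) ⟶ S), IsPullback i f₀ p x →
        Module.finrank Γ(Spec (CommRingCat.of K), ⊤) (SecMod ((Scheme.Modules.pullback i).obj G) f₀.appTop.hom ⊤) = r)
    (u : freeModule S (Fin r) ⟶ (Scheme.Modules.pushforward p).obj G) :
    ∃ U : S.Opens, ∀ {T XT : Scheme.{0}} (g : T ⟶ S) {pr : XT ⟶ X} {pT : XT ⟶ T} (H : IsPullback pr pT p g),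
      (∃ g' : T ⟶ (U : Scheme.{0}), g' ≫ U.ι = g) ↔
        IsIso ((Scheme.Modules.pullback g).map u ≫ pushforwardBaseChangeHom H.w G) :=
  exists_opens_forall_exists_comp_ι_iff_isIso_comp_pushforwardBaseChangeHom G
    (hasRank_pushforward_of_forall_fieldPoint G hL hN r hvan hrank) hL hN hvan u

/-- The same over a quasi-compact locally Noetherian base (no affine-localizing hypothesis; ★
`hasRank_pushforward_of_forall_fieldPoint_of_compactSpace`).
[cite: MumfordFogartyKirwan1994, Ch. 7 §2 Prop. 7.3, step (VI) of the proof (p. 134)] [cite: StacksProject, Tag 05P8] -/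
theorem exists_opens_forall_exists_comp_ι_iff_isIso_comp_pushforwardBaseChangeHom_of_forall_fieldPoint_of_compactSpace
    [CompactSpace S] (hL : IsFiniteLocallyFree G) (r : ℕ)
    (hvan : ∀ ⦃K : Type⦄ [Field K] ⦃X₀ : Scheme.{0}⦄ (i : X₀ ⟶ X) (f₀ : X₀ ⟶ Spec (CommRingCat.of K))
      (x : Spec (CommRingCat.of K) ⟶ S), IsPullback i f₀ p x →
        Subsingleton (Ext.{1} (unitModule X₀) ((Scheme.Modules.pullback i).obj G) 1))
    (hrank : ∀ ⦃K : Type⦄ [Field K] ⦃X₀ : Scheme.{0}⦄ (i : X₀ ⟶ X) (f₀ : X₀ ⟶ Spec (CommRingCat.of K))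
      (x : Spec (CommRingCat.of K) ⟶ S), IsPullback i f₀ p x →
        Module.finrank Γ(Spec (CommRingCat.of K), ⊤) (SecMod ((Scheme.Modules.pullback i).obj G) f₀.appTop.hom ⊤) = r)
    (u : freeModule S (Fin r) ⟶ (Scheme.Modules.pushforward p).obj G) :
    ∃ U : S.Opens, ∀ {T XT : Scheme.{0}} (g : T ⟶ S) {pr : XT ⟶ X} {pT : XT ⟶ T} (H : IsPullback pr pT p g),
      (∃ g' : T ⟶ (U : Scheme.{0}), g' ≫ U.ι = g) ↔
        IsIso ((Scheme.Modules.pullback g).map u ≫ pushforwardBaseChangeHom H.w G) :=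
  exists_opens_forall_exists_comp_ι_iff_isIso_comp_pushforwardBaseChangeHom_of_compactSpace G
    (hasRank_pushforward_of_forall_fieldPoint_of_compactSpace G hL r hvan hrank) hL hvan u

end OfForallFieldPoint

end Literature.AlgebraicGeometry.Modules

end
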